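import Summits.NavierStokesRegularity.NavierStokesRegularity.Theorems.PerpetualPumpAveragedTypeIBlowupSlavedLadderSteps

/-!
# Crux `PerpetualPump.AveragedTypeIBlowup` (stmt-NavierStokesRegularity-1835), line `Sketch`:
# stub `slavedLadder` — the slaved ladder above the front stays in its box

This file proves the registered stub `stub_slavedLadder` of the line skeleton
`Cruxes/AveragedTypeIBlowup/Lines/Sketch.lean` (G10, Mathlib-only). The modes two or more scales
above the front of the cascade (carriers `x_j`, bonds `y_j`, `j ≥ 2`, relative rates `κ_j ≥ 1`,
Duhamel majorants `mx_j`, `my_j` controlling the memory errors `ex_j`, `ey_j`) are driven only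
through the next-front bond `y₁` with `|y₁| ≤ Y₁`; if the box
`Π_j {|x_j| ≤ X_j, |y_j| ≤ Y_j, mx_j ≤ MX_j, my_j ≤ MY_j}` is closed under the forcings with a
factor-two slack (the four closure hypotheses), holds initially, and holds for the far levels
`j ≥ J` on the whole time interval, then it holds for every level `j ≥ 2` on `[0, σ₁]`.

Proof: a continuous induction in `σ` on the nonnegative total excess
`φ(σ) = ∑_{2 ≤ j < J} (max (|x_j σ| - X_j) 0 + max (|y_j σ| - Y_j) 0 + max (mx_j σ - MX_j) 0 +
max (my_j σ - MY_j) 0)`, a continuous function with `φ(0) = 0`; the box for the levels in play is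
`φ ≤ 0`. Suppose `φ ≤ 0` on `[0, S]`. By continuity there is a short window `[S, t]`,
`t - S ≤ δ₀ := 1/(4C + 1)` with `C := ∑_{2 ≤ j < J} κ_j L_j` (`L_j` an explicit affine function
of the box sizes), on which `φ ≤ 1`; let `N := max_{[S,t]} φ ∈ [0, 1]`. On `[S, t]` every mode of
every level (including the neighbours `y₁` and the far levels) exceeds its box by at most `N`, so
by the one-window estimates of `…SlavedLadderSteps` (damped max principle from time `S` for
`x_j, y_j`; exact Duhamel convexity for `mx_j, my_j`) each of the four quantities of level `j`
exceeds its box by at most `N L_j κ_j (σ - S)` for `σ ∈ [S, t]`. Summing,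
`φ ≤ 4 N C (t - S) ≤ (1 - δ₀) N` on `[S, t]`, whence `N ≤ (1 - δ₀) N`, `N = 0`, and `φ ≤ 0` on
`[S, t]`. The continuous induction (`slavedLadder_induction`) gives `φ ≤ 0` on `[0, σ₁]`.
This contraction form of the bootstrap needs no strict slack, so degenerate boxes (`X_j = 0`) and
exact initial equality `|x_j(0)| = X_j` are covered.

## References

Standard ODE comparison / bootstrap arguments (folklore), organised as in T. Tao, *Finite time
blowup for an averaged three-dimensional Navier–Stokes equation*, J. Amer. Math. Soc. 29 (2016),
§5–6.
-/

noncomputable section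

-- the summit namespace `…NavierStokesRegularity.NavierStokesRegularity…` is the tree convention
set_option linter.dupNamespace false

open MeasureTheory Set Filter Topology

namespace Summit.NavierStokesRegularity.NavierStokesRegularity.Theorems.PerpetualPumpAveragedTypeIBlowup

/-- **Registered stub `stub_slavedLadder`** (G10, line `Sketch` of crux
`PerpetualPump.AveragedTypeIBlowup`, stmt-NavierStokesRegularity-1835). SLAVED MODES ABOVE THE
FRONT: the ladder of carriers/bonds two or more scales above the front (`j ≥ 2`, relative rates
`κ_j ≥ 1`), fed only by the next-front bond `y₁` (`|y₁| ≤ Y₁`), stays in a prescribed box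
`|x_j| ≤ X_j, |y_j| ≤ Y_j`, majorants `≤ MX_j, MY_j`, provided the box is closed under the forcings
with a factor-2 slack (four algebraic closure inequalities), holds at time `0`, and holds for the
far tail `j ≥ J` — continuous induction on the total excess of the finitely many levels
`2 ≤ j < J`, each bootstrap step being a contraction of the maximal excess on a short window.
[folklore] -/
theorem stub_slavedLadder :
    ∀ (x y mx my ex ey : ℕ → ℝ → ℝ) (X Y MX MY κ : ℕ → ℝ) (q θ η εb σ₁ : ℝ) (J : ℕ),
      1 ≤ q → 1 / 2 ≤ θ → θ ≤ 1 → 0 ≤ η → 0 < εb → 0 ≤ σ₁ → 2 ≤ J →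
      (∀ j : ℕ, 2 ≤ j → 1 ≤ κ j) →
      (∀ j : ℕ, 1 ≤ j → 0 ≤ X j ∧ 0 ≤ Y j ∧ 0 ≤ MX j ∧ 0 ≤ MY j) → (∀ j : ℕ, 2 ≤ j → X j ≤ 1 / 4) →
      (∀ j : ℕ, 2 ≤ j →
        Y (j - 1) ^ 2 / q ^ 3 + Y j ^ 2 + εb * X j * Y j + η * MX j ≤ X j / 2 ∧
        εb * X j ^ 2 + η * MY j ≤ Y j / 4 ∧
        (Y (j - 1) ^ 2 / q ^ 3 + Y j ^ 2 + εb * X j * Y j) / θ ≤ MX j / 2 ∧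
        (Y j * (X j + X (j + 1) / q + 1) + εb * X j ^ 2) / θ ≤ MY j / 2) →
      (∀ j : ℕ, 2 ≤ j → ContinuousOn (x j) (Icc 0 σ₁) ∧ ContinuousOn (y j) (Icc 0 σ₁) ∧
        ContinuousOn (mx j) (Icc 0 σ₁) ∧ ContinuousOn (my j) (Icc 0 σ₁) ∧
        ContinuousOn (ex j) (Icc 0 σ₁) ∧ ContinuousOn (ey j) (Icc 0 σ₁)) →
      ContinuousOn (y 1) (Icc 0 σ₁) →
      (∀ j : ℕ, 2 ≤ j → ∀ σ ∈ Ioo 0 σ₁, HasDerivAt (x j)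
        (κ j * (-(x j σ) + (y (j - 1) σ) ^ 2 / q ^ 3 - (y j σ) ^ 2 - εb * x j σ * y j σ) + ex j σ) σ) →
      (∀ j : ℕ, 2 ≤ j → ∀ σ ∈ Ioo 0 σ₁, HasDerivAt (y j)
        (κ j * (y j σ * (x j σ - x (j + 1) σ / q - 1) + εb * (x j σ) ^ 2) + ey j σ) σ) →
      (∀ j : ℕ, 2 ≤ j → ∀ σ ∈ Icc 0 σ₁, |ex j σ| ≤ η * κ j * mx j σ ∧ |ey j σ| ≤ η * κ j * my j σ) →
      (∀ j : ℕ, 2 ≤ j → ∀ σ ∈ Icc 0 σ₁, 0 ≤ mx j σ ∧ mx j σ ≤ mx j 0 * Real.exp (-(θ * κ j * σ)) +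
        κ j * ∫ u in (0 : ℝ)..σ, Real.exp (-(θ * κ j * (σ - u))) *
          |(y (j - 1) u) ^ 2 / q ^ 3 - (y j u) ^ 2 - εb * x j u * y j u|) →
      (∀ j : ℕ, 2 ≤ j → ∀ σ ∈ Icc 0 σ₁, 0 ≤ my j σ ∧ my j σ ≤ my j 0 * Real.exp (-(θ * κ j * σ)) +
        κ j * ∫ u in (0 : ℝ)..σ, Real.exp (-(θ * κ j * (σ - u))) *
          |y j u * (x j u - x (j + 1) u / q) + εb * (x j u) ^ 2|) →
      (∀ σ ∈ Icc 0 σ₁, |y 1 σ| ≤ Y 1) →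
      (∀ j : ℕ, J ≤ j → ∀ σ ∈ Icc 0 σ₁, |x j σ| ≤ X j ∧ |y j σ| ≤ Y j ∧ mx j σ ≤ MX j ∧ my j σ ≤ MY j) →
      (∀ j : ℕ, 2 ≤ j → |x j 0| ≤ X j ∧ |y j 0| ≤ Y j ∧ mx j 0 ≤ MX j ∧ my j 0 ≤ MY j) →
      ∀ j : ℕ, 2 ≤ j → ∀ σ ∈ Icc 0 σ₁, |x j σ| ≤ X j ∧ |y j σ| ≤ Y j ∧ mx j σ ≤ MX j ∧ my j σ ≤ MY j := by
  intro x y mx my ex ey X Y MX MY κ q θ η εb σ₁ J hq hθ _hθ1 hη hεb _hσ₁ _hJ hκ hnn hX hcl hcont hy1c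
    hdx hdy herr hmx hmy hy1 hfar hinit
  have hθ0 : 0 < θ := by linarith
  have hyc : ∀ i : ℕ, 1 ≤ i → ContinuousOn (y i) (Icc 0 σ₁) := by
    intro i hi
    rcases eq_or_lt_of_le hi with h | h
    · subst h
      exact hy1c
    · exact (hcont i h).2.1
  -- the excess functions and their sum over the finitely many levels in play
  obtain ⟨E, hE⟩ : ∃ E : ℕ → ℝ → ℝ, ∀ j σ, E j σ = max (|x j σ| - X j) 0 + max (|y j σ| - Y j) 0 +
      max (mx j σ - MX j) 0 + max (my j σ - MY j) 0 := ⟨fun j σ => _, fun _ _ => rfl⟩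
  obtain ⟨φ, hφ⟩ : ∃ φ : ℝ → ℝ, ∀ σ, φ σ = ∑ j ∈ Finset.Ico 2 J, E j σ :=
    ⟨fun σ => _, fun _ => rfl⟩
  have hE0 : ∀ j σ, 0 ≤ E j σ := by
    intro j σ
    rw [hE]
    have h1 := le_max_right (|x j σ| - X j) 0
    have h2 := le_max_right (|y j σ| - Y j) 0
    have h3 := le_max_right (mx j σ - MX j) 0
    have h4 := le_max_right (my j σ - MY j) 0
    linarith
  have hφ0 : ∀ σ, 0 ≤ φ σ := fun σ => by
    rw [hφ]
    exact Finset.sum_nonneg fun j _ => hE0 j σ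
  have hEφ : ∀ j, 2 ≤ j → j < J → ∀ σ, E j σ ≤ φ σ := by
    intro j hj hjJ σ
    rw [hφ]
    exact Finset.single_le_sum (fun i _ => hE0 i σ) (Finset.mem_Ico.2 ⟨hj, hjJ⟩)
  -- the (enlarged) box from `φ σ ≤ ν`, uniformly in the level
  have hbox : ∀ ν σ, 0 ≤ ν → σ ∈ Icc 0 σ₁ → φ σ ≤ ν →
      (∀ i, 2 ≤ i → |x i σ| ≤ X i + ν ∧ mx i σ ≤ MX i + ν ∧ my i σ ≤ MY i + ν) ∧
      (∀ i, 1 ≤ i → |y i σ| ≤ Y i + ν) := by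
    intro ν σ hν hσ hφν
    have main : ∀ i, 2 ≤ i →
        |x i σ| ≤ X i + ν ∧ |y i σ| ≤ Y i + ν ∧ mx i σ ≤ MX i + ν ∧ my i σ ≤ MY i + ν := by
      intro i hi
      rcases lt_or_ge i J with hiJ | hJi
      · have h := (hEφ i hi hiJ σ).trans hφν
        rw [hE] at h
        exact slavedLadder_extract h
      · obtain ⟨h1, h2, h3, h4⟩ := hfar i hJi σ hσ
        exact ⟨by linarith, by linarith, by linarith, by linarith⟩
    refine ⟨fun i hi => ⟨(main i hi).1, (main i hi).2.2⟩, fun i hi => ?_⟩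
    rcases eq_or_lt_of_le hi with h | h
    · subst h
      linarith [hy1 σ hσ]
    · exact (main i h).2.1
  have hφc : ContinuousOn φ (Icc 0 σ₁) := by
    rw [show φ = fun σ => ∑ j ∈ Finset.Ico 2 J, E j σ from funext hφ]
    refine continuousOn_finsetSum _ fun j hj => ?_
    obtain ⟨hxc, hyc', hmxc, hmyc, -, -⟩ := hcont j (Finset.mem_Ico.1 hj).1
    rw [show E j = _ from funext (hE j)]
    fun_prop
  have hφinit : φ 0 ≤ 0 := by
    rw [hφ]
    refine Finset.sum_nonpos fun j hj => ?_
    obtain ⟨h1, h2, h3, h4⟩ := hinit j (Finset.mem_Ico.1 hj).1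
    rw [hE]
    linarith [max_le (show |x j 0| - X j ≤ 0 by linarith) (le_refl (0 : ℝ)),
      max_le (show |y j 0| - Y j ≤ 0 by linarith) (le_refl (0 : ℝ)),
      max_le (show mx j 0 - MX j ≤ 0 by linarith) (le_refl (0 : ℝ)),
      max_le (show my j 0 - MY j ≤ 0 by linarith) (le_refl (0 : ℝ))]
  -- the contraction constants
  obtain ⟨L, hL⟩ : ∃ L : ℕ → ℝ, ∀ j, L j =
      2 * Y (j - 1) + 2 * Y j + X j + X (j + 1) + 3 + εb * (2 * X j + Y j + 1) + η :=
    ⟨fun j => _, fun _ => rfl⟩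
  have hL0 : ∀ j, 2 ≤ j → 0 ≤ L j := by
    intro j hj
    obtain ⟨hXj, hYj, -, -⟩ := hnn j (by omega)
    obtain ⟨-, hYm, -, -⟩ := hnn (j - 1) (by omega)
    obtain ⟨hXp, -, -, -⟩ := hnn (j + 1) (by omega)
    rw [hL]
    nlinarith [mul_nonneg hεb.le hXj, mul_nonneg hεb.le hYj]
  obtain ⟨C, hC⟩ : ∃ C : ℝ, C = ∑ j ∈ Finset.Ico 2 J, κ j * L j := ⟨_, rfl⟩
  have hC0 : 0 ≤ C := by
    rw [hC]
    exact Finset.sum_nonneg fun j hj =>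
      mul_nonneg (by linarith [hκ j (Finset.mem_Ico.1 hj).1]) (hL0 j (Finset.mem_Ico.1 hj).1)
  have h41 : 0 < 4 * C + 1 := by linarith
  obtain ⟨δ₀, hδ₀⟩ : ∃ δ₀ : ℝ, δ₀ = 1 / (4 * C + 1) := ⟨_, rfl⟩
  have hδpos : 0 < δ₀ := by rw [hδ₀]; positivity
  have hδ1 : δ₀ * (4 * C + 1) = 1 := by rw [hδ₀]; exact one_div_mul_cancel h41.ne'
  -- the main claim: the box holds for the levels in play on all of `[0, σ₁]`
  suffices key : ∀ σ ∈ Icc 0 σ₁, φ σ ≤ 0 by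
    intro j hj σ hσ
    obtain ⟨hb1, hb2⟩ := hbox 0 σ le_rfl hσ (key σ hσ)
    obtain ⟨h1, h3, h4⟩ := hb1 j hj
    have h2 := hb2 j (by omega)
    refine ⟨by linarith, by linarith, by linarith, by linarith⟩
  refine slavedLadder_induction hφc hφinit fun S hS hboxS => ?_
  obtain ⟨t, ht, htδ, hφ1⟩ := slavedLadder_local_small hS hδpos hφc (hboxS S (right_mem_Icc.2 hS.1))
  obtain ⟨σ₀, hσ₀, hmax⟩ := isCompact_Icc.exists_isMaxOn (nonempty_Icc.2 ht.1.le)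
    (hφc.mono (Icc_subset_Icc hS.1 ht.2))
  obtain ⟨N, hN⟩ : ∃ N : ℝ, N = φ σ₀ := ⟨_, rfl⟩
  have hN0 : 0 ≤ N := hN ▸ hφ0 σ₀
  have hN1 : N ≤ 1 := hN ▸ hφ1 σ₀ hσ₀
  have hNmax : ∀ u ∈ Icc S t, φ u ≤ N := fun u hu => hN ▸ isMaxOn_iff.1 hmax u hu
  have hS0 : 0 ≤ S := hS.1
  have hSt : S ≤ t := ht.1.le
  have htσ₁ : t ≤ σ₁ := ht.2
  have b0 := fun u (hu : u ∈ Icc 0 S) =>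
    hbox 0 u le_rfl ⟨hu.1, hu.2.trans hS.2.le⟩ (hboxS u hu)
  have bN := fun u (hu : u ∈ Icc S t) =>
    hbox N u hN0 ⟨hS0.trans hu.1, hu.2.trans htσ₁⟩ (hNmax u hu)
  -- per-level contraction estimate
  have hlevel : ∀ j, 2 ≤ j → j < J → ∀ σ ∈ Icc S t,
      E j σ ≤ 4 * (N * L j * (κ j * (t - S))) := by
    intro j hj _hjJ σ hσ
    have hj1 : 1 ≤ j - 1 := by omega
    obtain ⟨hXj, hYj, hMXj, hMYj⟩ := hnn j (by omega)
    obtain ⟨-, hYm, -, -⟩ := hnn (j - 1) hj1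
    obtain ⟨hXp, -, -, -⟩ := hnn (j + 1) (by omega)
    obtain ⟨c1, c2, c3, c4⟩ := hcl j hj
    obtain ⟨hxc, hyc', -, -, -, -⟩ := hcont j hj
    have hymc := hyc (j - 1) hj1
    have hxpc := (hcont (j + 1) (by omega)).1
    have hk := hκ j hj
    have hσ01 : σ ∈ Icc 0 σ₁ := ⟨hS0.trans hσ.1, hσ.2.trans htσ₁⟩
    have b0x : ∀ u ∈ Icc 0 S, |x j u| ≤ X j := fun u hu => by
      have h := ((b0 u hu).1 j hj).1
      rwa [add_zero] at h
    have b0y : ∀ u ∈ Icc 0 S, |y j u| ≤ Y j := fun u hu => by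
      have h := (b0 u hu).2 j (by omega)
      rwa [add_zero] at h
    have b0ym : ∀ u ∈ Icc 0 S, |y (j - 1) u| ≤ Y (j - 1) := fun u hu => by
      have h := (b0 u hu).2 (j - 1) hj1
      rwa [add_zero] at h
    have b0xp : ∀ u ∈ Icc 0 S, |x (j + 1) u| ≤ X (j + 1) := fun u hu => by
      have h := ((b0 u hu).1 (j + 1) (by omega)).1
      rwa [add_zero] at h
    have bx : ∀ u ∈ Icc S t, |x j u| ≤ X j + N := fun u hu => ((bN u hu).1 j hj).1
    have bmx : ∀ u ∈ Icc S t, mx j u ≤ MX j + N := fun u hu => ((bN u hu).1 j hj).2.1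
    have bmy : ∀ u ∈ Icc S t, my j u ≤ MY j + N := fun u hu => ((bN u hu).1 j hj).2.2
    have by_ : ∀ u ∈ Icc S t, |y j u| ≤ Y j + N := fun u hu => (bN u hu).2 j (by omega)
    have bym : ∀ u ∈ Icc S t, |y (j - 1) u| ≤ Y (j - 1) + N := fun u hu => (bN u hu).2 (j - 1) hj1
    have bxp : ∀ u ∈ Icc S t, |x (j + 1) u| ≤ X (j + 1) + N := fun u hu =>
      ((bN u hu).1 (j + 1) (by omega)).1
    have hLj := hL j
    have Λ1 : 2 * Y (j - 1) + 2 * Y j + 2 + εb * (X j + Y j + 1) + η ≤ L j := by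
      rw [hLj]; nlinarith [mul_nonneg hεb.le hXj]
    have Λ2 : 2 * Y j + X j + X (j + 1) + 2 + εb * (2 * X j + 1) + η ≤ L j := by
      rw [hLj]; nlinarith [mul_nonneg hεb.le hYj]
    have Λ3 : 2 * Y (j - 1) + 2 * Y j + 2 + εb * (X j + Y j + 1) ≤ L j := by linarith
    have Λ4 : 2 * Y j + X j + X (j + 1) + 2 + εb * (2 * X j + 1) ≤ L j := by linarith
    have ex := slavedLadder_x_step hq hεb.le hη hk hYj hYm hN0 hN1 Λ1 c1 hS0 hSt htσ₁ hxc (hdx j hj)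
      (fun u hu => (herr j hj u hu).1) (b0x S (right_mem_Icc.2 hS0)) bx by_ bym bmx σ hσ
    have ey := slavedLadder_y_step hq hεb.le hη hk hXj (hX j hj) hXp (hX (j + 1) (by omega)) hYj
      hN0 hN1 Λ2 c2 hS0 hSt htσ₁ hyc' (hdy j hj) (fun u hu => (herr j hj u hu).2)
      (b0y S (right_mem_Icc.2 hS0)) bx bxp by_ bmy σ hσ
    have emx := slavedLadder_mx_step hq hεb.le hθ0 hk hYm hMXj hN0 hN1 Λ3 c3 hS0 hσ.1 hσ01.2
      hxc hyc' hymc (hmx j hj σ hσ01).2 (hinit j hj).2.2.1 b0x b0y b0ym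
      (fun u hu => bx u ⟨hu.1, hu.2.trans hσ.2⟩) (fun u hu => by_ u ⟨hu.1, hu.2.trans hσ.2⟩)
      (fun u hu => bym u ⟨hu.1, hu.2.trans hσ.2⟩)
    have emy := slavedLadder_my_step hq hεb.le hθ0 hk hXp hYj hMYj hN0 hN1 Λ4 c4 hS0 hσ.1 hσ01.2
      hxc hyc' hxpc (hmy j hj σ hσ01).2 (hinit j hj).2.2.2 b0x b0xp b0y
      (fun u hu => bx u ⟨hu.1, hu.2.trans hσ.2⟩) (fun u hu => bxp u ⟨hu.1, hu.2.trans hσ.2⟩)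
      (fun u hu => by_ u ⟨hu.1, hu.2.trans hσ.2⟩)
    have hmono : N * L j * (κ j * (σ - S)) ≤ N * L j * (κ j * (t - S)) :=
      mul_le_mul_of_nonneg_left (mul_le_mul_of_nonneg_left (by linarith [hσ.2]) (by linarith))
        (mul_nonneg hN0 (hL0 j hj))
    rw [hE]
    exact slavedLadder_collect (mul_nonneg (mul_nonneg hN0 (hL0 j hj))
      (mul_nonneg (by linarith) (by linarith))) (ex.trans (by linarith)) (ey.trans (by linarith))
      (emx.trans (by linarith)) (emy.trans (by linarith))
  -- summing the levels: `φ ≤ 4 N (t - S) C ≤ (1 - δ₀) N` on `[S, t]`, so `N = max φ ≤ 0`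
  have hsum : ∀ σ ∈ Icc S t, φ σ ≤ 4 * (N * (t - S)) * C := by
    intro σ hσ
    rw [hφ, hC, Finset.mul_sum]
    refine Finset.sum_le_sum fun j hj => ?_
    have := hlevel j (Finset.mem_Ico.1 hj).1 (Finset.mem_Ico.1 hj).2 σ hσ
    linarith
  have hNle : N ≤ 4 * (N * (t - S)) * C := hN ▸ hsum σ₀ hσ₀
  have hN4 : 4 * (N * (t - S)) * C ≤ 4 * (N * δ₀) * C :=
    mul_le_mul_of_nonneg_right (mul_le_mul_of_nonneg_left
      (mul_le_mul_of_nonneg_left (by linarith) hN0) (by norm_num)) hC0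
  have hNz : N ≤ 0 := by nlinarith
  exact ⟨t, ht, fun u hu => (hNmax u hu).trans hNz⟩

end Summit.NavierStokesRegularity.NavierStokesRegularity.Theorems.PerpetualPumpAveragedTypeIBlowup

end
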